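import Literature.MathematicalPhysics.QuantumFieldTheory.PlaquetteWeightTorusDobrushin

/-!
# Crux `IR` (item stmt-QuantumFields-19354) — line «maximal correlation at one physical thickness»:
COUNTING ON THE TORUS and the DOBRUSHIN SUPER-SOLUTION around one boundary link

Helper module for item `stmt-QuantumFields-19354` (`--supports … --as helper`; it closes nothing; lead prover
ym-ir-line-mxc-p1, g2).  Combinatorial inputs of hypothesis (H3) (Schur bound on the Gram rows of the one-link tilting
factors) of the abstract maximal-correlation theorem `HeatBath.integral_sq_kernelAvg_sub_le`
(`Theorems/IR/ShellMaxCorrTransfer.lean`) for the torus `(ℤ/L)^d`: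

* §1 `card_filter_torusNorm_le` — at most `(2k+1)^d` sites have periodic sup-norm `≤ k` (injectivity of
  `ZMod.valMinAbs`); the lattice sum `∑_w α^{max(1,‖w‖)} ≤ (1 + 2·3^d) α` for
  `3^d α ≤ 1/2` (`sum_pow_max_torusNorm_le`, fibrewise over the norm + a geometric series) and its link version
  `∑_{e'} α^{max(1,‖z − e'‖)} ≤ d (1 + 2·3^d) α` (`sum_links_pow_max_torusNorm_le`).
* §2 `superSolution_boundaryLink` — for Dobrushin coefficients `C ≥ 0` on the plaquette-neighbour graph with row sums
  `≤ α ≤ 1`, the vector `d_z = 1` at the boundary link `e'` and `d_z = α^{max(1, ‖z − e'‖)}` elsewhere satisfies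
  `∑_{z ∈ nbr x} C x z d_z ≤ d_x` for every `x ≠ e'` (plaquette neighbours have base points at distance `≤ 1`) — the
  super-solution fed to the tree's `DobrushinMetric.abs_kernel_sub_le_of_superSolution` in `…TorusGram.lean`: the
  influence of the boundary link `e'` on a link at distance `m` is `≤ α^{max(1,m)}`.

HONEST FRAMING: lattice combinatorics; nothing here is a statement about measures, `ShellRung`, or any mass gap.
-/

set_option autoImplicit false

noncomputable section

open Finset Function Real
open Literature.MathematicalPhysics.QuantumFieldTheory

namespace Summit.QuantumFields.YangMills.Cruxes.IR.ShellMaxCorr.TorusTilt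

variable {d L : ℕ} [NeZero L]

/-! ## §1 Counting sites and links by periodic sup-norm -/

/-- At most `(2k+1)^d` torus sites have periodic sup-norm `≤ k`. -/
theorem card_filter_torusNorm_le (k : ℕ) :
    (univ.filter fun w : Site d L => torusNorm w ≤ k).card ≤ (2 * k + 1) ^ d := by
  classical
  set f : Site d L → (Fin d → ℤ) := fun w i => (w i).valMinAbs with hf
  have hinj : Set.InjOn f ↑(univ.filter fun w : Site d L => torusNorm w ≤ k) := by
    intro w _ w' _ h
    funext i
    exact ZMod.injective_valMinAbs (congrFun h i)
  have hmaps : ∀ w ∈ univ.filter (fun w : Site d L => torusNorm w ≤ k),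
      f w ∈ Fintype.piFinset fun _ : Fin d => Finset.Icc (-(k : ℤ)) k := by
    intro w hw
    rw [Fintype.mem_piFinset]
    intro i
    rw [Finset.mem_Icc]
    have h1 : ((w i).valMinAbs).natAbs ≤ k := (natAbs_valMinAbs_le_torusNorm w i).trans (mem_filter.1 hw).2
    have h2 : |(w i).valMinAbs| ≤ (k : ℤ) := by
      rw [Int.abs_eq_natAbs]; exact_mod_cast h1
    exact abs_le.1 h2
  calc (univ.filter fun w : Site d L => torusNorm w ≤ k).card
      ≤ (Fintype.piFinset fun _ : Fin d => Finset.Icc (-(k : ℤ)) k).card :=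
        Finset.card_le_card_of_injOn f hmaps hinj
    _ = (2 * k + 1) ^ d := by
        rw [Fintype.card_piFinset, prod_const, card_univ, Fintype.card_fin, Int.card_Icc]
        congr 1
        omega

/-- The number of sites of periodic sup-norm EXACTLY `k` is at most `(3^d)^k`. -/
theorem card_filter_torusNorm_eq_le (k : ℕ) :
    ((univ.filter fun w : Site d L => torusNorm w = k).card : ℝ) ≤ ((3 : ℝ) ^ d) ^ k := by
  have h1 : (univ.filter fun w : Site d L => torusNorm w = k).card ≤ (2 * k + 1) ^ d :=
    (card_le_card (fun w hw => by
      rw [mem_filter] at hw ⊢; exact ⟨hw.1, hw.2.le⟩)).trans (card_filter_torusNorm_le k)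
  -- `2k + 1 ≤ 3^k` (also in the tree as `Literature.Probability.LatticeModels.two_mul_add_one_le_three_pow`)
  have h3 : ∀ n : ℕ, 2 * n + 1 ≤ 3 ^ n := fun n => by
    induction n with
    | zero => simp
    | succ n ih => rw [pow_succ]; omega
  have h2 : (2 * k + 1) ^ d ≤ (3 ^ k) ^ d := Nat.pow_le_pow_left (h3 k) d
  calc ((univ.filter fun w : Site d L => torusNorm w = k).card : ℝ) ≤ ((3 ^ k) ^ d : ℕ) := by
        exact_mod_cast h1.trans h2
    _ = ((3 : ℝ) ^ d) ^ k := by push_cast; rw [← pow_mul, ← pow_mul, mul_comm]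

/-- **Lattice sum** `∑_w α^{max(1,‖w‖)} ≤ (1 + 2·3^d)·α` for `0 ≤ α` with `3^d α ≤ 1/2`. -/
theorem sum_pow_max_torusNorm_le {α : ℝ} (hα0 : 0 ≤ α) (hα : (3 : ℝ) ^ d * α ≤ 1 / 2) :
    ∑ w : Site d L, α ^ max 1 (torusNorm w) ≤ (1 + 2 * (3 : ℝ) ^ d) * α := by
  classical
  set x : ℝ := (3 : ℝ) ^ d * α with hx
  have hx0 : 0 ≤ x := by positivity
  have hx1 : x < 1 := by linarith
  -- fibrewise over the norm, which is `≤ L`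
  have hB : ∀ w ∈ (univ : Finset (Site d L)), torusNorm w ∈ range (L + 1) := fun w _ => by
    rw [mem_range]
    have : torusNorm w ≤ L / 2 := Finset.sup_le fun i _ => ZMod.natAbs_valMinAbs_le (w i)
    omega
  rw [← sum_fiberwise_of_maps_to hB]
  have hfib : ∀ k ∈ range (L + 1),
      ∑ w ∈ univ.filter (fun w : Site d L => torusNorm w = k), α ^ max 1 (torusNorm w) ≤
        ((3 : ℝ) ^ d) ^ k * α ^ max 1 k := by
    intro k _
    rw [sum_congr rfl fun w hw => by rw [(mem_filter.1 hw).2], sum_const, nsmul_eq_mul]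
    exact mul_le_mul_of_nonneg_right (card_filter_torusNorm_eq_le k) (pow_nonneg hα0 _)
  refine (sum_le_sum hfib).trans ?_
  rw [sum_range_succ']
  simp only [pow_zero, one_mul, max_eq_left (Nat.zero_le 1), pow_one]
  -- the terms with `k ≥ 1`: a geometric series in `x = 3^d α`
  have hterm : ∀ k : ℕ, ((3 : ℝ) ^ d) ^ (k + 1) * α ^ max 1 (k + 1) = x * x ^ k := by
    intro k
    rw [max_eq_right (Nat.le_add_left 1 k), hx, mul_pow, pow_succ, pow_succ]
    ring
  simp_rw [hterm, ← mul_sum]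
  have hgeom : ∑ k ∈ range L, x ^ k ≤ 1 / (1 - x) := by
    have h := geom_sum_Ico_le_of_lt_one (m := 0) (n := L) hx0 hx1
    rw [pow_zero, ← range_eq_Ico] at h
    exact h
  have hx2 : x * (1 / (1 - x)) ≤ 2 * x := by
    rw [mul_one_div, div_le_iff₀ (by linarith)]
    nlinarith
  calc x * ∑ k ∈ range L, x ^ k + α ≤ x * (1 / (1 - x)) + α := by
        gcongr
    _ ≤ 2 * x + α := by linarith
    _ = (1 + 2 * (3 : ℝ) ^ d) * α := by rw [hx]; ring

/-- **Link version**: `∑_{e'} α^{max(1, ‖z − e'‖)} ≤ d (1 + 2·3^d) α` (base points, all links of the torus). -/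
theorem sum_links_pow_max_torusNorm_le {α : ℝ} (hα0 : 0 ≤ α) (hα : (3 : ℝ) ^ d * α ≤ 1 / 2) (z : Edge d L) :
    ∑ e' : Edge d L, α ^ max 1 (torusNorm (z.1 - e'.1)) ≤ d * ((1 + 2 * (3 : ℝ) ^ d) * α) := by
  classical
  have h1 : ∑ e' : Edge d L, α ^ max 1 (torusNorm (z.1 - e'.1)) =
      ∑ y : Site d L, ∑ _i : Fin d, α ^ max 1 (torusNorm (z.1 - y)) := by
    rw [← Finset.univ_product_univ, sum_product]
  have h2 : ∑ y : Site d L, α ^ max 1 (torusNorm (z.1 - y)) = ∑ w : Site d L, α ^ max 1 (torusNorm w) :=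
    Fintype.sum_equiv (Equiv.subLeft z.1) _ _ fun y => rfl
  rw [h1]
  simp_rw [sum_const, card_univ, Fintype.card_fin, nsmul_eq_mul]
  rw [← mul_sum, h2]
  exact mul_le_mul_of_nonneg_left (sum_pow_max_torusNorm_le hα0 hα) (Nat.cast_nonneg d)

/-! ## §2 The Dobrushin super-solution around one boundary link -/

/-- **Super-solution.**  For nonnegative coefficients `C` on the plaquette-neighbour graph with row sums `≤ α ≤ 1` and
a distinguished link `e'`, the vector `d z = if z = e' then 1 else α^{max(1, ‖z.1 − e'.1‖)}` satisfies
`∑_{z ∈ linkNbrT x} C x z · d z ≤ d x` for every `x ≠ e'`. -/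
theorem superSolution_boundaryLink {C : Edge d L → Edge d L → ℝ} (hC0 : ∀ x z, 0 ≤ C x z) {α : ℝ}
    (hα0 : 0 ≤ α) (hα1 : α ≤ 1) (hrow : ∀ x, ∑ z ∈ linkNbrT x, C x z ≤ α) (e' x : Edge d L) (hx : x ≠ e') :
    ∑ z ∈ linkNbrT x, C x z * (if z = e' then 1 else α ^ max 1 (torusNorm (z.1 - e'.1))) ≤
      (if x = e' then 1 else α ^ max 1 (torusNorm (x.1 - e'.1))) := by
  classical
  rw [if_neg hx]
  set m : ℕ := torusNorm (x.1 - e'.1) with hm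
  have hk : 1 ≤ max 1 m := le_max_left _ _
  -- every neighbour has weight `≤ α^{max(1,m) - 1}`
  have hbd : ∀ z ∈ linkNbrT x,
      (if z = e' then 1 else α ^ max 1 (torusNorm (z.1 - e'.1))) ≤ α ^ (max 1 m - 1) := by
    intro z hz
    have hxz : torusNorm (x.1 - z.1) ≤ 1 := torusNorm_sub_le_one_of_mem_linkNbrT hz
    have htri : m ≤ torusNorm (x.1 - z.1) + torusNorm (z.1 - e'.1) := torusNorm_sub_le _ _ _
    by_cases hze : z = e'
    · subst hze
      rw [if_pos rfl]
      have : max 1 m = 1 := by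
        refine max_eq_left ?_
        rw [sub_self, torusNorm_zero] at htri
        omega
      rw [this]; simp
    · rw [if_neg hze]
      exact pow_le_pow_of_le_one hα0 hα1 (by omega)
  calc ∑ z ∈ linkNbrT x, C x z * (if z = e' then 1 else α ^ max 1 (torusNorm (z.1 - e'.1)))
      ≤ ∑ z ∈ linkNbrT x, C x z * α ^ (max 1 m - 1) :=
        sum_le_sum fun z hz => mul_le_mul_of_nonneg_left (hbd z hz) (hC0 x z)
    _ = (∑ z ∈ linkNbrT x, C x z) * α ^ (max 1 m - 1) := by rw [sum_mul]
    _ ≤ α * α ^ (max 1 m - 1) := mul_le_mul_of_nonneg_right (hrow x) (pow_nonneg hα0 _)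
    _ = α ^ max 1 m := by rw [← pow_succ', Nat.sub_add_cancel hk]

end Summit.QuantumFields.YangMills.Cruxes.IR.ShellMaxCorr.TorusTilt

end
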